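import Literature.NumberTheory.EllipticCurves.KummerSelmerGroupFinite
import Literature.NumberTheory.EllipticCurves.MordellWeilBasisProofs
import Literature.NumberTheory.EllipticCurves.TwoDescent
import Literature.NumberTheory.EllipticCurves.TwoDescentParity
import Literature.NumberTheory.EllipticCurves.WeakMordellWeilSplitField
import HarnessLib

/-!
# The weak Mordell–Weil theorem (`m = 2`) and the Mordell–Weil theorem: proofs
# (Silverman AEC Thm. VIII.1.1, Thm. VIII.6.7)

This file discharges the named facts `WeierstrassCurve.weakMordellWeil_two`
(`WeakMordellWeil.lean`; Silverman, *The Arithmetic of Elliptic Curves*, 2nd ed., Thm. VIII.1.1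
with `m = 2`: for an elliptic curve `E` over a number field `K`, `E(K)/2E(K)` is finite),
`WeierstrassCurve.module_finite_point` (`MordellWeil.lean`; the Mordell–Weil theorem
AEC Thm. VIII.6.7: `E(K)` is finitely generated) and `WeierstrassCurve.exists_isMordellWeilBasis`
(`MordellWeil.lean`; existence of a Mordell–Weil basis `P₁, …, P_r`, `r = rank_ℤ E(K)`,
AEC VIII.6) by assembling the pieces of Silverman's proof (VIII.§1, VIII.§3, VIII.§6 and X.§1)
that live in the sibling files:

1. **Reduction to rational `2`-torsion** (AEC Lemma VIII.1.1.1 and the remark following its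
   proof): it suffices to treat
   the base change of `E` to the number field `L = K(E[2])`, over which
   `Ψ₂Sq = 4(X - e₁)(X - e₂)(X - e₃)` — `WeierstrassCurve.weakMordellWeil_two_of_split`
   (`WeakMordellWeilSplitField.lean`, using `finite_quotient_nsmul_of_finite_quotient_baseChange`
   of `WeakMordellWeilReduction.lean` and the finiteness of `E[2]`, `TwoTorsion.lean`).
2. **Complete `2`-descent** (AEC Prop. X.1.4): over such `L` the map
   `P = (x, y) ↦ (x - e₁, x - e₂) ∈ Lˣ/(Lˣ)² × Lˣ/(Lˣ)²` is a homomorphism with kernel `2E(L)`, so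
   `E(L)/2E(L)` is finite once both components take values in a finite set —
   `WeierstrassCurve.Affine.Point.finite_quotient_two_of_subset` (`TwoDescent.lean`).
3. **The image lies in `L(S, 2) × L(S, 2)`** (AEC Thm. X.1.1(c)) for the finite set `S` of primes
   at which some `eᵢ` is non-integral or some `eᵢ - eⱼ` is a non-unit: the parity statement
   `ord_v(x - eᵢ) ≡ 0 (mod 2)` for `v ∉ S` —
   `IsDedekindDomain.HeightOneSpectrum.two_dvd_log_valuation_twoDescent` and
   `exists_finite_twoDescent_unramified` (`TwoDescentParity.lean`), turned here into membership
   in Mathlib's Selmer group `IsDedekindDomain.selmerGroup` via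
   `IsDedekindDomain.mk_mem_selmerGroup_iff` (`KummerSelmerGroupFinite.lean`).
4. **`L(S, 2)` is finite** (AEC Prop. VIII.1.6): `NumberField.finite_selmerGroup`
   (`KummerSelmerGroupFinite.lean`).

Main results:

* `WeierstrassCurve.Affine.SplitTwoTorsion.Ψ₂Sq_eq_prod`: rational `2`-torsion in the sense of
  `TwoDescent.lean` is the factorisation `Ψ₂Sq = 4(X - e₁)(X - e₂)(X - e₃)` (link with
  `TwoTorsion.lean` and `WeakMordellWeilSplitField.lean`).
* `NumberField.mk0_sub_mem_selmerGroup_two`, `NumberField.mk0_mul_sub_mem_selmerGroup_two`: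
  the classes of `x - e₁` (`x ≠ e₁`) and of `(e₁ - e₂)(e₁ - e₃)` lie in `L⟮S, 2⟯`.
* `WeierstrassCurve.Affine.Point.twoDescentComponent_mem_selmerGroup`: every value of the
  `2`-descent component lies in `L⟮S, 2⟯` (AEC Thm. X.1.1(c) / Prop. X.1.4, "injective
  homomorphism `E(K)/2E(K) → K(S, 2) × K(S, 2)`", the part "`→ K(S, 2)`").
* `WeierstrassCurve.Affine.Point.finite_quotient_two_of_splitTwoTorsion`: **weak Mordell–Weil in
  the split case**: for an elliptic curve over a number field with rational `2`-torsion,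
  `E(L)/2E(L)` is finite.
* `WeierstrassCurve.weakMordellWeil_two_holds : W.weakMordellWeil_two` — **AEC Thm. VIII.1.1
  (`m = 2`) proved.**
* `WeierstrassCurve.module_finite_point_holds : W.module_finite_point` — **the Mordell–Weil
  theorem AEC VIII.6.7 proved**: weak Mordell–Weil + the descent theorem VIII.3.1
  (`MordellWeil.descent_theorem_holds`, `DescentTheorem.lean`) with the height estimates
  VIII.6.1/6.2/6.4 (`HeightsProofs.lean`), as packaged in
  `addGroup_fg_point_of_finite_quotient_two_nsmul` (`MordellWeilBasisProofs.lean`).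
* `WeierstrassCurve.exists_isMordellWeilBasis_holds : W.exists_isMordellWeilBasis` — existence of
  a Mordell–Weil basis (VIII.6.7 + structure theorem of finitely generated abelian groups,
  `exists_isMordellWeilBasis_of_weakMordellWeil_two`, `MordellWeilBasisProofs.lean`).

Theorems only; `noncomputable section`, `open scoped Classical` and no `[DecidableEq]`
variables, as in `WeakMordellWeil.lean` (the group law on points and the `if` in
`twoDescentComponent` are elaborated against the classical instances).

## References

* J. H. Silverman, *The Arithmetic of Elliptic Curves*, 2nd ed., GTM 106, Springer 2009
  (page numbers of the Springer PDF as served by `lit read`): Thm. VIII.1.1 and Lemma VIII.1.1.1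
  (p. 184), the reduction remark (p. 185), Prop. VIII.1.6 (p. 188), Thm. VIII.3.1 (p. 193),
  Thm. VIII.6.7 (pp. 207–208); Thm. X.1.1(c) (p. 267), Remark X.1.2, Prop. X.1.4 (p. 270).
  [SilvermanAEC2009]
-/

noncomputable section

open scoped Classical

open IsDedekindDomain

/-! ## Rational `2`-torsion and the `2`-division polynomial -/

namespace WeierstrassCurve.Affine.SplitTwoTorsion

variable {F : Type*} [Field F] {W : Affine F} {e₁ e₂ e₃ : F}

open Polynomial in
/-- **`SplitTwoTorsion` is the factorisation of the `2`-division polynomial**: if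
`W.SplitTwoTorsion e₁ e₂ e₃` (`TwoDescent.lean`: `b₂ = -4Σeᵢ`, `b₄ = 2Σeᵢeⱼ`, `b₆ = -4e₁e₂e₃`)
then `Ψ₂Sq = 4X³ + b₂X² + 2b₄X + b₆ = 4(X - e₁)(X - e₂)(X - e₃)` (Mathlib
`WeierstrassCurve.Ψ₂Sq_eq`), the form produced over `K(E[2])` by
`WeierstrassCurve.exists_numberField_isGalois_splitTwoTorsion` (`WeakMordellWeilSplitField.lean`,
whose `b_eq_of_Ψ₂Sq_eq` is the converse) and whose roots are the abscissae of the `2`-torsion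
points (`TwoTorsion.lean`). Silverman AEC III.§1 (`b`-invariants), Prop. X.1.4 (hypothesis
`E[2] ⊆ E(K)`). [folklore] -/
theorem Ψ₂Sq_eq_prod (h : W.SplitTwoTorsion e₁ e₂ e₃) :
    W.Ψ₂Sq = C 4 * (X - C e₁) * (X - C e₂) * (X - C e₃) := by
  rw [WeierstrassCurve.Ψ₂Sq_eq, Cubic.C_mul_prod_X_sub_C_eq, twoTorsionPolynomial, h.b₂_eq,
    h.b₄_eq, h.b₆_eq]
  congr 2 <;> ring

end WeierstrassCurve.Affine.SplitTwoTorsion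

/-! ## From parity of valuations to membership in `L(S, 2)` -/

namespace NumberField

variable {L : Type*} [Field L] [NumberField L]

/-- **The class of `x - e₁` lies in `L(S, 2)`** (Silverman AEC Thm. X.1.1(c) for the `2`-descent
function `f_{T₁} = x - e₁`, Prop. X.1.4): if outside `S` all `eᵢ` are integral and all
`eᵢ - eⱼ` are units, and `y² = (x - e₁)(x - e₂)(x - e₃)` with `x ≠ e₁`, then
`(x - e₁) mod (Lˣ)² ∈ L⟮S, 2⟯`, Mathlib's `IsDedekindDomain.selmerGroup` (membership is
`2 ∣ ord_v` for `v ∉ S`, `IsDedekindDomain.mk_mem_selmerGroup_iff`; the parity is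
`IsDedekindDomain.HeightOneSpectrum.two_dvd_log_valuation_twoDescent`).
[cite: SilvermanAEC2009, Thm. X.1.1(c)] -/
theorem mk0_sub_mem_selmerGroup_two {S : Set (HeightOneSpectrum (𝓞 L))} {e₁ e₂ e₃ : L}
    (hS : ∀ v ∉ S, v.valuation L e₁ ≤ 1 ∧ v.valuation L e₂ ≤ 1 ∧ v.valuation L e₃ ≤ 1 ∧
      v.valuation L (e₁ - e₂) = 1 ∧ v.valuation L (e₁ - e₃) = 1 ∧ v.valuation L (e₂ - e₃) = 1)
    {x y : L} (hy : y ^ 2 = (x - e₁) * (x - e₂) * (x - e₃)) (hx : x ≠ e₁) :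
    (QuotientGroup.mk (Units.mk0 (x - e₁) (sub_ne_zero.mpr hx)) :
        Lˣ ⧸ (powMonoidHom 2 : Lˣ →* Lˣ).range) ∈
      selmerGroup (R := 𝓞 L) (K := L) (S := S) (n := 2) := by
  rw [mk_mem_selmerGroup_iff]
  intro v hv
  exact_mod_cast (HeightOneSpectrum.two_dvd_log_valuation_twoDescent hS hy v hv).1 hx

/-- **The class of `(e₁ - e₂)(e₁ - e₃)` lies in `L(S, 2)`** (the value of the `2`-descent map at
the `2`-torsion point `T₁`, Silverman AEC Prop. X.1.4): it is a unit outside `S`.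
[cite: SilvermanAEC2009, Prop. X.1.4] -/
theorem mk0_mul_sub_mem_selmerGroup_two {S : Set (HeightOneSpectrum (𝓞 L))} {e₁ e₂ e₃ : L}
    (hS : ∀ v ∉ S, v.valuation L e₁ ≤ 1 ∧ v.valuation L e₂ ≤ 1 ∧ v.valuation L e₃ ≤ 1 ∧
      v.valuation L (e₁ - e₂) = 1 ∧ v.valuation L (e₁ - e₃) = 1 ∧ v.valuation L (e₂ - e₃) = 1)
    (hne : (e₁ - e₂) * (e₁ - e₃) ≠ 0) :
    (QuotientGroup.mk (Units.mk0 ((e₁ - e₂) * (e₁ - e₃)) hne) :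
        Lˣ ⧸ (powMonoidHom 2 : Lˣ →* Lˣ).range) ∈
      selmerGroup (R := 𝓞 L) (K := L) (S := S) (n := 2) := by
  rw [mk_mem_selmerGroup_iff]
  intro v hv
  obtain ⟨-, -, -, h₁₂, h₁₃, -⟩ := hS v hv
  rw [Units.val_mk0, (v.valuation L).log_map_mul_sub_eq_zero h₁₂ h₁₃]
  exact dvd_zero _

/-- The unramifiedness conditions outside `S` are symmetric under `e₁ ↔ e₂` (used for the second
component `x - e₂` of the descent map). [folklore] -/
theorem twoDescent_unramified_swap₁₂ {S : Set (HeightOneSpectrum (𝓞 L))} {e₁ e₂ e₃ : L}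
    (hS : ∀ v ∉ S, v.valuation L e₁ ≤ 1 ∧ v.valuation L e₂ ≤ 1 ∧ v.valuation L e₃ ≤ 1 ∧
      v.valuation L (e₁ - e₂) = 1 ∧ v.valuation L (e₁ - e₃) = 1 ∧ v.valuation L (e₂ - e₃) = 1) :
    ∀ v ∉ S, v.valuation L e₂ ≤ 1 ∧ v.valuation L e₁ ≤ 1 ∧ v.valuation L e₃ ≤ 1 ∧
      v.valuation L (e₂ - e₁) = 1 ∧ v.valuation L (e₂ - e₃) = 1 ∧
        v.valuation L (e₁ - e₃) = 1 := by
  intro v hv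
  obtain ⟨he₁, he₂, he₃, h₁₂, h₁₃, h₂₃⟩ := hS v hv
  exact ⟨he₂, he₁, he₃, by rw [Valuation.map_sub_swap, h₁₂], h₂₃, h₁₃⟩

end NumberField

/-! ## Weak Mordell–Weil in the split case -/

namespace WeierstrassCurve.Affine.Point

open NumberField

variable {L : Type*} [Field L] [NumberField L] {W : Affine L} [W.IsElliptic] {e₁ e₂ e₃ : L}

/-- **The `2`-descent map takes values in `L(S, 2)`** (Silverman AEC Thm. X.1.1(c) and
Prop. X.1.4: "there is an injective homomorphism `E(K)/2E(K) → K(S, 2) × K(S, 2)`", the part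
concerning the target). For an elliptic curve over a number field `L` with rational `2`-torsion
`e₁, e₂, e₃` (`SplitTwoTorsion`) and a set `S` of primes outside of which the `eᵢ` are integral
and the `eᵢ - eⱼ` are units, every value of `twoDescentComponent W e₁ e₂ e₃` lies in the Selmer
group `L⟮S, 2⟯ ⊆ Lˣ/(Lˣ)²`. (`O ↦ 1`; `T₁ ↦ (e₁ - e₂)(e₁ - e₃)`, a unit outside `S`;
`(x, y) ↦ x - e₁` with `ord_v(x - e₁)` even by the parity lemma applied to
`(y + (a₁x + a₃)/2)² = (x - e₁)(x - e₂)(x - e₃)`.) [cite: SilvermanAEC2009, Prop. X.1.4] -/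
theorem twoDescentComponent_mem_selmerGroup (h : W.SplitTwoTorsion e₁ e₂ e₃)
    {S : Set (HeightOneSpectrum (𝓞 L))}
    (hS : ∀ v ∉ S, v.valuation L e₁ ≤ 1 ∧ v.valuation L e₂ ≤ 1 ∧ v.valuation L e₃ ≤ 1 ∧
      v.valuation L (e₁ - e₂) = 1 ∧ v.valuation L (e₁ - e₃) = 1 ∧ v.valuation L (e₂ - e₃) = 1)
    (P : W.Point) :
    twoDescentComponent W e₁ e₂ e₃ P ∈
      (selmerGroup (R := 𝓞 L) (K := L) (S := S) (n := 2) : Set (SqUnits L)) := by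
  rcases P with _ | ⟨x, y, hP⟩
  · show twoDescentComponent W e₁ e₂ e₃ 0 ∈ _
    rw [twoDescentComponent_zero]
    exact one_mem _
  · by_cases hx : x = e₁
    · rw [twoDescentComponent_some_of_eq hP hx, sqClass_of_ne_zero h.c_ne_zero]
      exact mk0_mul_sub_mem_selmerGroup_two hS h.c_ne_zero
    · rw [twoDescentComponent_some_of_ne hP hx, sqClass_of_ne_zero (sub_ne_zero.mpr hx)]
      exact mk0_sub_mem_selmerGroup_two hS (sq_eq_mul_mul_of_equation h hP.1) hx

/-- **The weak Mordell–Weil theorem in the split case** (Silverman AEC Thm. VIII.1.1 for `m = 2`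
under the assumption `E[2] ⊆ E(L)`, via the complete `2`-descent Prop. X.1.4 and the
finiteness of `L(S, 2)`, Prop. VIII.1.6): for an elliptic curve `W` over a number field `L`
whose `2`-division cubic splits as `4(x - e₁)(x - e₂)(x - e₃)` over `L`, the group `E(L)/2E(L)`
is finite. Proof: choose the finite set `S` of `exists_finite_twoDescent_unramified`; both
components of the `2`-descent map lie in the finite group `L⟮S, 2⟯`
(`twoDescentComponent_mem_selmerGroup`, `NumberField.finite_selmerGroup`), and the descent map
has kernel `2E(L)` (`finite_quotient_two_of_subset`). [cite: SilvermanAEC2009, Thm. VIII.1.1] -/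
theorem finite_quotient_two_of_splitTwoTorsion (h : W.SplitTwoTorsion e₁ e₂ e₃) :
    Finite (W.Point ⧸ (nsmulAddMonoidHom 2 : W.Point →+ W.Point).range) := by
  obtain ⟨S, hSfin, hS⟩ :=
    HeightOneSpectrum.exists_finite_twoDescent_unramified (R := 𝓞 L) h.ne₁₂ h.ne₁₃ h.ne₂₃
  haveI : Finite (selmerGroup (R := 𝓞 L) (K := L) (S := S) (n := 2)) :=
    NumberField.finite_selmerGroup L hSfin two_pos
  exact finite_quotient_two_of_subset h
    (T := (selmerGroup (R := 𝓞 L) (K := L) (S := S) (n := 2) : Set (SqUnits L)))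
    (Set.toFinite _) (fun P => twoDescentComponent_mem_selmerGroup h hS P)
    (fun P => twoDescentComponent_mem_selmerGroup h.swap₁₂ (twoDescent_unramified_swap₁₂ hS) P)

end WeierstrassCurve.Affine.Point

/-! ## The weak Mordell–Weil theorem (`m = 2`) -/

namespace WeierstrassCurve

universe u

variable {K : Type u} [Field K] (W : WeierstrassCurve K)

/-- **The weak Mordell–Weil theorem for `m = 2` (Silverman AEC Thm. VIII.1.1), proved**: the
named fact `weakMordellWeil_two W` — for an elliptic curve `E` over a number field `K`, the group
`E(K)/2E(K)` is finite. Silverman's proof: by Lemma VIII.1.1.1 reduce to the number field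
`L = K(E[2])`, over which the `2`-torsion is rational (`weakMordellWeil_two_of_split`); there
the complete `2`-descent (Prop. X.1.4) embeds `E(L)/2E(L)` into `L(S, 2) × L(S, 2)`
(Thm. X.1.1(c)), which is finite (Prop. VIII.1.6) —
`Affine.Point.finite_quotient_two_of_splitTwoTorsion`. [cite: SilvermanAEC2009, Thm. VIII.1.1] -/
theorem weakMordellWeil_two_holds : W.weakMordellWeil_two :=
  W.weakMordellWeil_two_of_split fun L _ _ _ _ e₁ e₂ e₃ _ _ _ _ hb₂ hb₄ hb₆ => by
    haveI : (W.baseChange L).IsElliptic := inferInstanceAs (W.map (algebraMap K L)).IsElliptic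
    exact Affine.Point.finite_quotient_two_of_splitTwoTorsion (W := (W.baseChange L).toAffine)
      ⟨hb₂, hb₄, hb₆⟩

/-- The weak Mordell–Weil theorem for `m = 2`, unpacked: for an elliptic curve `W` over a number
field `K`, `E(K)/2E(K)` is finite (`2E(K)` = range of `nsmulAddMonoidHom 2` on
`E(K) = W.toAffine.Point`). Silverman AEC Thm. VIII.1.1 (`m = 2`).
[cite: SilvermanAEC2009, Thm. VIII.1.1] -/
theorem finite_quotient_two_nsmul_range [NumberField K] [W.IsElliptic] :
    Finite (W.toAffine.Point ⧸
      (nsmulAddMonoidHom 2 : W.toAffine.Point →+ W.toAffine.Point).range) :=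
  W.weakMordellWeil_two_holds

/-! ## The Mordell–Weil theorem (AEC Thm. VIII.6.7) and Mordell–Weil bases -/

/-- **The Mordell–Weil theorem (Silverman AEC Thm. VIII.6.7), proved**: the named fact
`module_finite_point W` — for an elliptic curve `E` over a number field `K`, `E(K)` is a finite
`ℤ`-module (finitely generated abelian group). Silverman's proof, verbatim: "immediately from the
weak Mordell–Weil theorem (VIII.1.1) with `m = 2`" (`weakMordellWeil_two_holds`) "and the descent
theorem (VIII.3.1)" applied to the height `h_x` with (i) VIII.6.4(a), (ii) VIII.6.4(b), (iii)
VIII.6.1 (`addGroup_fg_point_of_finite_quotient_two_nsmul`, `MordellWeilBasisProofs.lean`, from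
`MordellWeil.descent_theorem_holds` and `HeightsProofs.lean`), and Mathlib's
`Module.Finite.iff_addGroup_fg`. [cite: SilvermanAEC2009, Thm. VIII.6.7] -/
theorem module_finite_point_holds : W.module_finite_point := by
  intro _ _
  exact Module.Finite.iff_addGroup_fg.mpr
    (addGroup_fg_point_of_finite_quotient_two_nsmul W W.weakMordellWeil_two_holds)

/-- **The Mordell–Weil theorem, group form (Mordell 1922, Weil 1929; Silverman AEC Thm. VIII.6.7),
proved**: for an elliptic curve `E` over a number field `K`, `E(K)` is a finitely generated abelian
group. [cite: SilvermanAEC2009, Thm. VIII.6.7] -/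
theorem addGroup_fg_point_holds [NumberField K] [W.IsElliptic] : AddGroup.FG W.toAffine.Point :=
  addGroup_fg_point W W.module_finite_point_holds

/-- **Existence of a Mordell–Weil basis, proved**: the named fact `exists_isMordellWeilBasis W` —
an elliptic curve over a number field admits a Mordell–Weil basis `P₁, …, P_r`,
`r = rank_ℤ E(K)`, i.e. points whose classes form a `ℤ`-basis of `E(K)/E(K)_tors` (Silverman AEC
VIII.6: Thm. VIII.6.7 with the structure theorem of finitely generated abelian groups). From the
weak Mordell–Weil theorem `weakMordellWeil_two_holds` by
`exists_isMordellWeilBasis_of_weakMordellWeil_two` (`MordellWeilBasisProofs.lean`).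
[cite: SilvermanAEC2009, Thm. VIII.6.7] -/
theorem exists_isMordellWeilBasis_holds : W.exists_isMordellWeilBasis :=
  exists_isMordellWeilBasis_of_weakMordellWeil_two W W.weakMordellWeil_two_holds

end WeierstrassCurve

end
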